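import Mathlib
import Summits.Ventures.PercRepro2.CrossAPrimePendantMark

/-!
# The pendant-mark REDUCTION: a mark `b` hanging off ANY vertex `w` through a coin-bridge
(blind cell PercRepro2, p5 g37; S4 §2.4 (s) addendum 43)

`b` has exactly two edges, `f = {b, w}` (weight `β`) and the coin `g = {a₂, b}` (weight `r`), with
`b ∉ {o, a₁, a₂, v, w}` and `w` ARBITRARY.  Pin both: `p⁰⁰ = p[f ↦ 0][g ↦ 0]` (the graph without
`b`), `p¹⁰ = p[f ↦ 1][g ↦ 0]` (`b` a leaf at `w`: `b ∈ K ⟺ w ∈ K`, nothing else sees `b`),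
`p¹¹ = p[f ↦ 1][g ↦ 1]` (`a₂–b–w` sure).  The constant functional `crossC(p; π)`,
`π = P_p(a₁ ↔ v)`, is a quadratic along `f` whose pieces are quadratics along `g`; the bilinear
bookkeeping (`reduce_algebra`) gives the LOWER BOUND
`crossC(p; π)(o, b) ≥ β(1 − r)(1 − βr)·crossC(p⁰⁰; π)(o, w) + β²r(1 − r)·M_g`, `M_g` the mixed
coin term `Φ(p¹⁰, p¹¹) + Φ(p¹¹, p¹⁰)`, every other piece being nonnegative from `P¹¹(Q) ≤ P⁰⁰(Q)`
and the admissibility of `π` for `p⁰⁰`, `p¹¹` (**`crossC_pendant_lower_bound`**).  Hence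
(`CrossAPrimePendantReduceCases.crossA'so_nonneg_of_pendant_reduce`) the sign of `crossA′so` at
`(o, b)` follows from the crux at `(o, w)` on the graph WITHOUT `b` together with `M_g ≥ 0` — a rule
contracting a coin-leaf mark onto its attachment vertex (`w = o`: `CrossAPrimePendantMark`; `w = v`,
`w = a₁`: `CrossAPrimePendantReduceCases`).  No claim on `M_g ≥ 0` for a general `w` (exact census 300 / 300
at `c = π`, no proof).  Own work; standard axioms. -/

namespace Summit.Ventures.PercRepro2

open LeafRowPendantRootSO CrossAPrimeA2Route CrossAPrimeSupport CrossAPrimeA2Induction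
  CrossAPrimeA2VEdge CrossAPrimeIsolatedFlip CrossAPrimeMarkAtV CrossAPrimePendantMark

namespace CrossAPrimePendantReduce

section Algebra

variable {R : Type*} [Field R] [LinearOrder R] [IsStrictOrderedRing R]

/-- **The lower bound of the pendant reduction**, as pure algebra: with the masses of `p[f ↦ 0]`
(`Z0 … Dv0`) and of `p[f ↦ 1]` (`Z1 … Dv1`) expressed through the masses of `p⁰⁰` at the pair
`(o, w)` (`Zs xs ys xvs yvs Ds Zvs`) and of `p¹¹` (`Zg xg xvg Zvg`), the quadratic along `f` is at
least `β(1 − r)(1 − βr)·crux(p⁰⁰; o, w) + β²r(1 − r)·M_g`: the difference is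
`r(1 − β)²·E₀ + β(1 − β)r(1 − r)·S₁ + β(1 − β)r²·S₂ + β²r²·Φ₁₁` with four nonnegative blocks. -/
lemma reduce_algebra {β r π Z0 x0 y0 xv0 yv0 Dv0 Z1 x1 y1 xv1 yv1 Dv1
    Zs xs ys xvs yvs Ds Zvs Zg xg xvg Zvg : R}
    (hβ0 : 0 ≤ β) (hβ1 : β ≤ 1) (hr0 : 0 ≤ r) (hr1 : r ≤ 1)
    (hZs : 0 ≤ Zs) (hxs : 0 ≤ xs) (hxvs : 0 ≤ xvs) (hZg : 0 ≤ Zg) (hxg : 0 ≤ xg) (hxvg : 0 ≤ xvg)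
    (hZgs : Zg ≤ Zs) (hZvg : Zvg ≤ π * Zg) (hZvs : Zvs ≤ π * Zs)
    (hZ0 : Z0 = Zs) (hx0 : x0 = xs) (hxv0 : xv0 = xvs) (hy0 : y0 = r * Zs) (hyv0 : yv0 = r * Zvs)
    (hDv0 : Dv0 = r * xvs)
    (hZ1 : Z1 = r * Zg + (1 - r) * Zs) (hx1 : x1 = r * xg + (1 - r) * xs)
    (hy1 : y1 = r * Zg + (1 - r) * ys) (hxv1 : xv1 = r * xvg + (1 - r) * xvs)
    (hyv1 : yv1 = r * Zvg + (1 - r) * yvs) (hDv1 : Dv1 = r * xvg + (1 - r) * Ds) :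
    β * (1 - r) * (1 - β * r) * (2 * Zs * Ds - ys * xvs + π * xs * ys - xs * yvs) +
        β ^ 2 * (r * (1 - r)) *
          ((2 * Zs * xvg - ys * xvg + π * xs * Zg - xs * Zvg) +
            (2 * Zg * Ds - Zg * xvs + π * xg * ys - xg * yvs)) ≤
      (1 - β) ^ 2 * (2 * Z0 * Dv0 - y0 * xv0 + π * x0 * y0 - x0 * yv0) +
        β * (1 - β) *
          ((2 * Z0 * Dv1 - y0 * xv1 + π * x0 * y1 - x0 * yv1) +
            (2 * Z1 * Dv0 - y1 * xv0 + π * x1 * y0 - x1 * yv0)) +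
        β ^ 2 * (2 * Z1 * Dv1 - y1 * xv1 + π * x1 * y1 - x1 * yv1) := by
  rw [hZ0, hx0, hxv0, hy0, hyv0, hDv0, hZ1, hx1, hy1, hxv1, hyv1, hDv1]
  have hr' : 0 ≤ 1 - r := by linarith
  have hβ' : 0 ≤ 1 - β := by linarith
  have hA : 0 ≤ π * Zs - Zvs := by linarith
  have hB : 0 ≤ π * Zg - Zvg := by linarith
  have hC : 0 ≤ Zs - Zg := by linarith
  have t1 : 0 ≤ r * (1 - β) ^ 2 * (Zs * xvs + xs * (π * Zs - Zvs)) :=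
    mul_nonneg (mul_nonneg hr0 (sq_nonneg _)) (add_nonneg (mul_nonneg hZs hxvs) (mul_nonneg hxs hA))
  have t2 : 0 ≤ β * (1 - β) * (r * (1 - r)) *
      ((Zs - Zg) * xvs + xs * (π * Zs - Zvs) + 2 * Zs * xvg + xs * (π * Zg - Zvg)) := by
    refine mul_nonneg (mul_nonneg (mul_nonneg hβ0 hβ') (mul_nonneg hr0 hr')) ?_
    have a1 : 0 ≤ (Zs - Zg) * xvs := mul_nonneg hC hxvs
    have a2 : 0 ≤ xs * (π * Zs - Zvs) := mul_nonneg hxs hA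
    have a3 : 0 ≤ 2 * Zs * xvg := mul_nonneg (mul_nonneg (by norm_num) hZs) hxvg
    have a4 : 0 ≤ xs * (π * Zg - Zvg) := mul_nonneg hxs hB
    linarith
  have t3 : 0 ≤ β * (1 - β) * r ^ 2 *
      (Zs * xvg + xs * (π * Zg - Zvg) + Zg * xvs + xg * (π * Zs - Zvs)) := by
    refine mul_nonneg (mul_nonneg (mul_nonneg hβ0 hβ') (sq_nonneg _)) ?_
    have a1 : 0 ≤ Zs * xvg := mul_nonneg hZs hxvg
    have a2 : 0 ≤ xs * (π * Zg - Zvg) := mul_nonneg hxs hB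
    have a3 : 0 ≤ Zg * xvs := mul_nonneg hZg hxvs
    have a4 : 0 ≤ xg * (π * Zs - Zvs) := mul_nonneg hxg hA
    linarith
  have t4 : 0 ≤ β ^ 2 * r ^ 2 * (Zg * xvg + xg * (π * Zg - Zvg)) :=
    mul_nonneg (mul_nonneg (sq_nonneg _) (sq_nonneg _)) (add_nonneg (mul_nonneg hZg hxvg) (mul_nonneg hxg hB))
  linear_combination t1 + t2 + t3 + t4

end Algebra

section Masses

variable {V : Type*} {E : Type*} [Fintype E] [DecidableEq E] {R : Type*} [Field R]
variable {ends : E → Sym2 V}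

omit [Fintype E] in
/-- Flipping the coin `g = {a₂, b}` at an isolated `b` keeps `Q`, `o ∈ K`, `a₁ ↔ v` and `w ∈ K`. -/
lemma flip4_iff_of_isolated {g : E} {o a₁ a₂ v b w : V} (hg : ends g = s(a₂, b)) {ω : Config E}
    (hiso : ∀ e', b ∈ ends e' → ω e' = false) (hba₁ : a₁ ≠ b) (hba₂ : a₂ ≠ b) (hbo : o ≠ b)
    (hbv : v ≠ b) (hbw : w ≠ b) :
    (Function.update ω g true ∈ avoidAll ends a₂ {a₁} ↔ ω ∈ avoidAll ends a₂ {a₁}) ∧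
      (Function.update ω g true ∈ connEvent ends a₂ o ↔ ω ∈ connEvent ends a₂ o) ∧
      (Function.update ω g true ∈ connEvent ends a₁ v ↔ ω ∈ connEvent ends a₁ v) ∧
      (Function.update ω g true ∈ connEvent ends a₂ w ↔ ω ∈ connEvent ends a₂ w) := by
  obtain ⟨h1, h2, h3⟩ := flip3_iff_of_isolated (o := o) (v := v) hg hiso hba₁ hba₂ hbo hbv
  exact ⟨h1, h2, h3, conn_update_true_iff_of_isolated hg hiso hba₂ hbw⟩

omit [Fintype E] in
/-- Flipping the leaf edge `f = {b, w}` at an isolated `b` keeps `Q`, `o ∈ K`, `a₁ ↔ v`, `w ∈ K`. -/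
lemma flipf_iff_of_isolated {f : E} {o a₁ a₂ v b w : V} (hf : ends f = s(b, w)) {ω : Config E}
    (hiso : ∀ e', b ∈ ends e' → ω e' = false) (hba₁ : a₁ ≠ b) (hba₂ : a₂ ≠ b) (hbo : o ≠ b)
    (hbv : v ≠ b) (hbw : w ≠ b) :
    (Function.update ω f true ∈ avoidAll ends a₂ {a₁} ↔ ω ∈ avoidAll ends a₂ {a₁}) ∧
      (Function.update ω f true ∈ connEvent ends a₂ o ↔ ω ∈ connEvent ends a₂ o) ∧
      (Function.update ω f true ∈ connEvent ends a₁ v ↔ ω ∈ connEvent ends a₁ v) ∧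
      (Function.update ω f true ∈ connEvent ends a₂ w ↔ ω ∈ connEvent ends a₂ w) := by
  have hf' : ends f = s(w, b) := by rw [hf, Sym2.eq_swap]
  refine ⟨?_, ?_, ?_, ?_⟩
  · simp only [avoidAll, Set.mem_setOf_eq, Finset.mem_singleton, forall_eq]
    rw [conn_update_true_iff_of_isolated hf' hiso hba₂ hba₁]
  · exact conn_update_true_iff_of_isolated hf' hiso hba₂ hbo
  · exact conn_update_true_iff_of_isolated hf' hiso hba₁ hbv
  · exact conn_update_true_iff_of_isolated hf' hiso hba₂ hbw

/-- Under `p[f ↦ 0]` an event invisible to the coin `g` at the isolated `b` has the probability of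
`p[f ↦ 0][g ↦ 0]`. -/
lemma prob_f0_eq_f0g0 (p : E → R) {f g : E} {b : V} (hb : ∀ e, b ∈ ends e → e = f ∨ e = g)
    (hfg : f ≠ g) (X : Set (Config E))
    (hX : ∀ ω : Config E, (∀ e, b ∈ ends e → ω e = false) →
      (Function.update ω g true ∈ X ↔ ω ∈ X)) :
    prob (Function.update p f 0) X = prob (Function.update (Function.update p f 0) g 0) X := by
  have hflip : prob (Function.update (Function.update p f 0) g 1) X =
      prob (Function.update (Function.update p f 0) g 0) X := by
    refine prob_update_one_eq_update_zero_of_isolated (ends := ends) _ (z := b) ?_ hX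
    intro e' he' hne
    rcases hb e' he' with rfl | rfl
    · simp
    · exact absurd rfl hne
  have hpin := prob_eq_pin (Function.update p f 0) X g
  rw [hflip] at hpin
  linear_combination hpin

/-- Under `p[g ↦ 0]` an event invisible to the leaf edge `f` at the isolated `b` has the same
probability with `f` pinned open or closed. -/
lemma prob_g0f1_eq_g0f0 (p : E → R) {f g : E} {b : V} (hb : ∀ e, b ∈ ends e → e = f ∨ e = g)
    (hfg : f ≠ g) (X : Set (Config E))
    (hX : ∀ ω : Config E, (∀ e, b ∈ ends e → ω e = false) →
      (Function.update ω f true ∈ X ↔ ω ∈ X)) :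
    prob (Function.update (Function.update p f 1) g 0) X =
      prob (Function.update (Function.update p f 0) g 0) X := by
  rw [Function.update_comm hfg (1 : R) (0 : R) p, Function.update_comm hfg (0 : R) (0 : R) p]
  refine prob_update_one_eq_update_zero_of_isolated (ends := ends) _ (z := b) ?_ hX
  intro e' he' hne
  rcases hb e' he' with rfl | rfl
  · exact absurd rfl hne
  · simp

omit [DecidableEq E] in
/-- On the support of `p[f ↦ 1][g ↦ 0]` (`f = {b, w}`), `b ∈ K ⟺ w ∈ K`. -/
lemma prob_f1g0_bH_eq_wH (p : E → R) [DecidableEq E] {f g : E} {a₂ b w : V}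
    (hf : ends f = s(b, w)) (hfg : f ≠ g) (A : Set (Config E)) :
    prob (Function.update (Function.update p f 1) g 0) (A ∩ connEvent ends a₂ b) =
      prob (Function.update (Function.update p f 1) g 0) (A ∩ connEvent ends a₂ w) := by
  apply prob_congr_supp
  ext ω
  simp only [Set.mem_inter_iff]
  have hbw : ω ∈ supp (Function.update (Function.update p f 1) g 0) → Conn ends ω b w := by
    intro hs
    refine conn_of_openAdj ⟨f, (hs f).1 ?_, hf⟩
    rw [Function.update_of_ne hfg, Function.update_self]
  constructor
  · rintro ⟨⟨hA, hbK⟩, hs⟩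
    exact ⟨⟨hA, conn_trans hbK (hbw hs)⟩, hs⟩
  · rintro ⟨⟨hA, hwK⟩, hs⟩
    exact ⟨⟨hA, conn_trans hwK (conn_symm (hbw hs))⟩, hs⟩

omit [DecidableEq E] in
/-- On the support of `p[f ↦ 1][g ↦ 1]` (`g = {a₂, b}`), `b ∈ K` surely. -/
lemma prob_f1g1_bH (p : E → R) [DecidableEq E] {f g : E} {a₂ b : V} (hg : ends g = s(a₂, b))
    (A : Set (Config E)) :
    prob (Function.update (Function.update p f 1) g 1) (A ∩ connEvent ends a₂ b) =
      prob (Function.update (Function.update p f 1) g 1) A := by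
  apply prob_congr_supp
  ext ω
  simp only [Set.mem_inter_iff]
  constructor
  · rintro ⟨⟨hA, -⟩, hs⟩
    exact ⟨hA, hs⟩
  · rintro ⟨hA, hs⟩
    exact ⟨⟨hA, conn_of_openAdj ⟨g, (hs g).1 (by simp), hg⟩⟩, hs⟩

end Masses

section Side

variable {V : Type*} {E : Type*} [Fintype E] [DecidableEq E] [Fintype V] [DecidableEq V]
  {R : Type*} [Field R] [LinearOrder R] [IsStrictOrderedRing R]
variable {ends : E → Sym2 V}

omit [Fintype V] [DecidableEq V] in
/-- A decreasing event has a smaller probability with an edge pinned open than pinned closed. -/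
lemma prob_update_one_le_update_zero (p : E → R) (hp : IsProbVec p) (e : E) {A : Set (Config E)}
    (hA : IsLowerSet A) :
    prob (Function.update p e 1) A ≤ prob (Function.update p e 0) A := by
  have h := prob_update_zero_le_update_one p hp e hA.compl
  rw [prob_compl, prob_compl] at h
  linarith

omit [Fintype V] [DecidableEq V] in
/-- Pinning an edge closed lowers the probability of an increasing event. -/
lemma prob_update_zero_le (p : E → R) (hp : IsProbVec p) (e : E) {A : Set (Config E)}
    (hA : IsUpperSet A) : prob (Function.update p e 0) A ≤ prob p A := by
  rw [prob_eq_pin p A e]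
  have h := prob_update_zero_le_update_one p hp e hA
  have hq0 := hp.nonneg e
  have hq1 := hp.le_one e
  nlinarith [mul_le_mul_of_nonneg_left h hq0]

omit [Fintype V] [DecidableEq V] [IsStrictOrderedRing R] in
/-- Admissibility is monotone in the constant. -/
lemma adm_mono {p : E → R} {c c' : R} {a₁ a₂ v : V} (h : Adm p c ends a₁ a₂ v) (hc : c ≤ c') :
    Adm p c' ends a₁ a₂ v := fun W hW ha => (h W hW ha).trans hc

omit [Fintype V] [DecidableEq V] in
/-- `π = P_p(a₁ ↔ v)` is admissible for `p[f ↦ 0][g ↦ 0]`. -/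
lemma adm_pi_f0g0 (p : E → R) (hp : IsProbVec p) (f g : E) (a₁ a₂ v : V) :
    Adm (Function.update (Function.update p f 0) g 0) (prob p (connEvent ends a₁ v))
      ends a₁ a₂ v := by
  refine adm_mono (adm_pi_update_zero (ends := ends) (Function.update p f 0)
    (hp.update f le_rfl zero_le_one) g a₁ a₂ v) ?_
  exact prob_update_zero_le p hp f (isUpperSet_connEvent ends a₁ v)

omit [Fintype V] [DecidableEq V] in
/-- `π = P_p(a₁ ↔ v)` is admissible for `p[f ↦ 1][g ↦ 1]` when `f`, `g` are the two edges at `b`,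
`g = {a₂, b}`: the sure cluster of `a₂` contains `b`, so `a₁ ↔ v` off it does not see `f`, `g`. -/
lemma adm_pi_f1g1 (p : E → R) (hp : IsProbVec p) {f g : E} {a₁ a₂ v b w : V}
    (hf : ends f = s(b, w)) (hg : ends g = s(a₂, b)) :
    Adm (Function.update (Function.update p f 1) g 1) (prob p (connEvent ends a₁ v))
      ends a₁ a₂ v := by
  intro W hW _
  have hbW : b ∈ W := by
    refine hW ?_
    show Conn ends (sureConfig (Function.update (Function.update p f 1) g 1)) a₂ b
    refine conn_of_openAdj ⟨g, ?_, hg⟩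
    simp [sureConfig]
  have hgW : g ∈ touches ends W := mem_touches_of_ends hg (Or.inr hbW)
  have hfW : f ∈ touches ends W := mem_touches_of_ends hf (Or.inl hbW)
  rw [prob_update_one_of_dependsOn' hgW (dependsOn_delConn W a₁ v),
    prob_update_one_of_dependsOn' hfW (dependsOn_delConn W a₁ v)]
  exact prob_mono hp fun ω hω => conn_mono (delConfig_le W ω) hω

end Side

section Main

variable {V : Type*} {E : Type*} [Fintype E] [DecidableEq E] [Fintype V] [DecidableEq V]
  {R : Type*} [Field R] [LinearOrder R] [IsStrictOrderedRing R]
variable {ends : E → Sym2 V}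

omit [DecidableEq V] in
/-- **The pendant-mark reduction, as a lower bound.**  `b` has exactly the edges `f = {b, w}` and
`g = {a₂, b}`; then `crossC(p; π)(o, b) ≥ β(1 − r)(1 − βr)·crossC(p⁰⁰; π)(o, w) + β²r(1 − r)·M_g`
with `β = p f`, `r = p g`, `π = P_p(a₁ ↔ v)`, `p⁰⁰ = p[f ↦ 0][g ↦ 0]` and
`M_g = Φ(p¹⁰, p¹¹) + Φ(p¹¹, p¹⁰)` the mixed coin term at the pair `(o, b)`. -/
theorem crossC_pendant_lower_bound (p : E → R) (hp : IsProbVec p) {f g : E}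
    {o a₁ a₂ v b w : V} (hf : ends f = s(b, w)) (hg : ends g = s(a₂, b))
    (hb : ∀ e, b ∈ ends e → e = f ∨ e = g) (hfg : f ≠ g)
    (hba₁ : a₁ ≠ b) (hba₂ : a₂ ≠ b) (hbo : o ≠ b) (hbv : v ≠ b) (hbw : w ≠ b) :
    p f * (1 - p g) * (1 - p f * p g) *
          crossC (Function.update (Function.update p f 0) g 0) (prob p (connEvent ends a₁ v))
            ends o a₁ a₂ v w +
        p f ^ 2 * (p g * (1 - p g)) *
          (crossPatC (Function.update (Function.update p f 1) g 0)
              (Function.update (Function.update p f 1) g 1) (prob p (connEvent ends a₁ v))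
              ends o a₁ a₂ v b +
            crossPatC (Function.update (Function.update p f 1) g 1)
              (Function.update (Function.update p f 1) g 0) (prob p (connEvent ends a₁ v))
              ends o a₁ a₂ v b) ≤
      crossC p (prob p (connEvent ends a₁ v)) ends o a₁ a₂ v b := by
  classical
  rw [crossC_pin_quadratic p _ ends f o a₁ a₂ v b, ← crossC_eq_crossPatC]
  set π := prob p (connEvent ends a₁ v) with hπ
  set Q := avoidAll ends a₂ {a₁} with hQ
  set oH := connEvent ends a₂ o
  set bH := connEvent ends a₂ b
  set wH := connEvent ends a₂ w
  set L := connEvent ends a₁ v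
  set p00 := Function.update (Function.update p f 0) g 0 with hp00
  set p10 := Function.update (Function.update p f 1) g 0 with hp10
  set p11 := Function.update (Function.update p f 1) g 1 with hp11
  have hq00 : IsProbVec p00 := (hp.update f le_rfl zero_le_one).update g le_rfl zero_le_one
  have hq11 : IsProbVec p11 := (hp.update f zero_le_one le_rfl).update g zero_le_one le_rfl
  have hβ0 : 0 ≤ p f := hp.nonneg f
  have hβ1 : p f ≤ 1 := hp.le_one f
  have hr0 : 0 ≤ p g := hp.nonneg g
  have hr1 : p g ≤ 1 := hp.le_one g
  -- flip invariance at the isolated `b`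
  have flipg : ∀ ω : Config E, (∀ e, b ∈ ends e → ω e = false) →
      ((Function.update ω g true ∈ Q ↔ ω ∈ Q) ∧ (Function.update ω g true ∈ oH ↔ ω ∈ oH) ∧
        (Function.update ω g true ∈ L ↔ ω ∈ L) ∧ (Function.update ω g true ∈ wH ↔ ω ∈ wH)) :=
    fun ω hiso => flip4_iff_of_isolated (o := o) (v := v) (w := w) hg hiso hba₁ hba₂ hbo hbv hbw
  have flipf : ∀ ω : Config E, (∀ e, b ∈ ends e → ω e = false) →
      ((Function.update ω f true ∈ Q ↔ ω ∈ Q) ∧ (Function.update ω f true ∈ oH ↔ ω ∈ oH) ∧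
        (Function.update ω f true ∈ L ↔ ω ∈ L) ∧ (Function.update ω f true ∈ wH ↔ ω ∈ wH)) :=
    fun ω hiso => flipf_iff_of_isolated (o := o) (v := v) (a₂ := a₂) hf hiso hba₁ hba₂ hbo hbv hbw
  -- the masses of `p[f ↦ 0]`: the independent mark, and the `b`-free masses are those of `p⁰⁰`
  have hy0 : prob (Function.update p f 0) (Q ∩ bH) = p g * prob (Function.update p f 0) Q := by
    have := prob_bH_eq (ends := ends) p hf hg hb hfg hba₁ hba₂ hbw hbv Set.univ (fun ω _ => by simp)
    simpa only [Set.univ_inter, Set.inter_univ] using this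
  have hyv0 : prob (Function.update p f 0) (Q ∩ (L ∩ bH)) =
      p g * prob (Function.update p f 0) (Q ∩ L) :=
    prob_bH_eq (ends := ends) p hf hg hb hfg hba₁ hba₂ hbw hbv L (fun ω hiso => (flipg ω hiso).2.2.1)
  have hDv0 : prob (Function.update p f 0) (Q ∩ (L ∩ (oH ∩ bH))) =
      p g * prob (Function.update p f 0) (Q ∩ (L ∩ oH)) := by
    have := prob_bH_eq (ends := ends) p hf hg hb hfg hba₁ hba₂ hbw hbv (L ∩ oH)
      (fun ω hiso => by
        simp only [Set.mem_inter_iff, (flipg ω hiso).2.1, (flipg ω hiso).2.2.1])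
    rwa [Set.inter_assoc L oH bH] at this
  have hZ0 : prob (Function.update p f 0) Q = prob p00 Q :=
    prob_f0_eq_f0g0 (ends := ends) p hb hfg Q (fun ω hiso => (flipg ω hiso).1)
  have hx0 : prob (Function.update p f 0) (Q ∩ oH) = prob p00 (Q ∩ oH) :=
    prob_f0_eq_f0g0 (ends := ends) p hb hfg (Q ∩ oH) (fun ω hiso => by
      simp only [Set.mem_inter_iff, (flipg ω hiso).1, (flipg ω hiso).2.1])
  have hxv0 : prob (Function.update p f 0) (Q ∩ (L ∩ oH)) = prob p00 (Q ∩ (L ∩ oH)) :=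
    prob_f0_eq_f0g0 (ends := ends) p hb hfg (Q ∩ (L ∩ oH)) (fun ω hiso => by
      simp only [Set.mem_inter_iff, (flipg ω hiso).1, (flipg ω hiso).2.1, (flipg ω hiso).2.2.1])
  have hZv0 : prob (Function.update p f 0) (Q ∩ L) = prob p00 (Q ∩ L) :=
    prob_f0_eq_f0g0 (ends := ends) p hb hfg (Q ∩ L) (fun ω hiso => by
      simp only [Set.mem_inter_iff, (flipg ω hiso).1, (flipg ω hiso).2.2.1])
  -- the masses of `p[f ↦ 1]` by the pinning of `g`
  have pin1 : ∀ X : Set (Config E), prob (Function.update p f 1) X =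
      p g * prob p11 X + (1 - p g) * prob p10 X := by
    intro X
    have := prob_eq_pin (Function.update p f 1) X g
    rwa [Function.update_of_ne hfg.symm] at this
  -- the masses of `p¹⁰`: `b ↔ w` on the support, then `b` invisible
  have m10 : ∀ A : Set (Config E), (∀ ω : Config E, (∀ e, b ∈ ends e → ω e = false) →
      (Function.update ω f true ∈ A ↔ ω ∈ A)) →
      prob p10 A = prob p00 A :=
    fun A hA => prob_g0f1_eq_g0f0 (ends := ends) p hb hfg A hA
  have hZ10 : prob p10 Q = prob p00 Q := m10 Q (fun ω hiso => (flipf ω hiso).1)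
  have hx10 : prob p10 (Q ∩ oH) = prob p00 (Q ∩ oH) := m10 (Q ∩ oH) (fun ω hiso => by
    simp only [Set.mem_inter_iff, (flipf ω hiso).1, (flipf ω hiso).2.1])
  have hxv10 : prob p10 (Q ∩ (L ∩ oH)) = prob p00 (Q ∩ (L ∩ oH)) :=
    m10 (Q ∩ (L ∩ oH)) (fun ω hiso => by
      simp only [Set.mem_inter_iff, (flipf ω hiso).1, (flipf ω hiso).2.1, (flipf ω hiso).2.2.1])
  have hy10 : prob p10 (Q ∩ bH) = prob p00 (Q ∩ wH) := by
    rw [prob_f1g0_bH_eq_wH (ends := ends) p hf hfg Q]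
    exact m10 (Q ∩ wH) (fun ω hiso => by
      simp only [Set.mem_inter_iff, (flipf ω hiso).1, (flipf ω hiso).2.2.2])
  have hyv10 : prob p10 (Q ∩ (L ∩ bH)) = prob p00 (Q ∩ (L ∩ wH)) := by
    rw [← Set.inter_assoc, prob_f1g0_bH_eq_wH (ends := ends) p hf hfg (Q ∩ L), Set.inter_assoc]
    exact m10 (Q ∩ (L ∩ wH)) (fun ω hiso => by
      simp only [Set.mem_inter_iff, (flipf ω hiso).1, (flipf ω hiso).2.2.1, (flipf ω hiso).2.2.2])
  have hDv10 : prob p10 (Q ∩ (L ∩ (oH ∩ bH))) = prob p00 (Q ∩ (L ∩ (oH ∩ wH))) := by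
    rw [← Set.inter_assoc, ← Set.inter_assoc, prob_f1g0_bH_eq_wH (ends := ends) p hf hfg (Q ∩ L ∩ oH),
      Set.inter_assoc, Set.inter_assoc]
    exact m10 (Q ∩ (L ∩ (oH ∩ wH))) (fun ω hiso => by
      simp only [Set.mem_inter_iff, (flipf ω hiso).1, (flipf ω hiso).2.1, (flipf ω hiso).2.2.1,
        (flipf ω hiso).2.2.2])
  -- the masses of `p¹¹`: `b ∈ K` surely
  have hy11 : prob p11 (Q ∩ bH) = prob p11 Q := prob_f1g1_bH (ends := ends) p hg Q
  have hyv11 : prob p11 (Q ∩ (L ∩ bH)) = prob p11 (Q ∩ L) := by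
    rw [← Set.inter_assoc]; exact prob_f1g1_bH (ends := ends) p hg (Q ∩ L)
  have hDv11 : prob p11 (Q ∩ (L ∩ (oH ∩ bH))) = prob p11 (Q ∩ (L ∩ oH)) := by
    rw [← Set.inter_assoc, ← Set.inter_assoc]
    rw [prob_f1g1_bH (ends := ends) p hg (Q ∩ L ∩ oH), Set.inter_assoc]
  -- the side facts
  have hZgs : prob p11 Q ≤ prob p00 Q := by
    rw [← hZ10]
    exact prob_update_one_le_update_zero (Function.update p f 1) (hp.update f zero_le_one le_rfl) g
      (fun ω ω' h hω y hy hc => hω y hy (conn_mono h hc))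
  have hZvg : prob p11 (Q ∩ L) ≤ π * prob p11 Q := by
    have key := prob_Q_vL_le_mul hq11
      (adm_pi_f1g1 (ends := ends) (a₁ := a₁) (v := v) p hp hf hg) (Set.univ : Set (Set V))
    have cu : clusterInEvent ends a₂ (Set.univ : Set (Set V)) = Set.univ := by
      ext ω; simp [clusterInEvent]
    rw [cu, Set.univ_inter, Set.univ_inter, Set.inter_comm] at key
    exact key
  have hZvs : prob p00 (Q ∩ L) ≤ π * prob p00 Q := by
    have key := prob_Q_vL_le_mul hq00 (adm_pi_f0g0 (ends := ends) p hp f g a₁ a₂ v)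
      (Set.univ : Set (Set V))
    have cu : clusterInEvent ends a₂ (Set.univ : Set (Set V)) = Set.univ := by
      ext ω; simp [clusterInEvent]
    rw [cu, Set.univ_inter, Set.univ_inter, Set.inter_comm] at key
    exact key
  -- assemble
  unfold crossC crossPatC
  rw [pin1 Q, pin1 (Q ∩ (L ∩ (oH ∩ bH))), pin1 (Q ∩ bH), pin1 (Q ∩ (L ∩ oH)), pin1 (Q ∩ oH),
    pin1 (Q ∩ (L ∩ bH))]
  rw [hy0, hyv0, hDv0, hZ0, hx0, hxv0, hZv0, hZ10, hx10, hxv10, hy10, hyv10, hDv10, hy11, hyv11,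
    hDv11]
  exact reduce_algebra hβ0 hβ1 hr0 hr1 (prob_nonneg hq00 _) (prob_nonneg hq00 _)
    (prob_nonneg hq00 _) (prob_nonneg hq11 _) (prob_nonneg hq11 _) (prob_nonneg hq11 _)
    hZgs hZvg hZvs rfl rfl rfl rfl rfl rfl rfl rfl rfl rfl rfl rfl

end Main

end CrossAPrimePendantReduce

end Summit.Ventures.PercRepro2
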